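import Literature.NumberTheory.EllipticCurves.Gamma0CocycleDegeneracyMaps
import HarnessLib

/-!
# A shift-invariant homomorphism on `Γ₀(N)` is a `T_ℓ`-eigenvector with eigenvalue `ℓ + 1`
# (E-es-25 / MEMO-es §21.2, the Eisenstein edge: `π_{1*} ∘ π_ℓ^* = T_ℓ` in degree `0`)

Summit `BirchSwinnertonDyer`, cruxes C3 `ManinPrimeToThreeAtNine` (stmt-BirchSwinnertonDyer-22968) and C2 `ManinOddAtFour`
(stmt-BirchSwinnertonDyer-22967) of route `ManinLocalTwoThree` (cell bsd-f2-manin), through E-es-25 (relative Ihara at a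
prime dividing the level, planner bsd-f2-manin-es g9, MEMO-es §21) — the single statement behind both generation stubs
(`stub_shiftClass_generation`, `stub_multiShiftClass_generation`; p3's cocycle reductions
`Theorems/ManinLocalTwoThreeGenerationCocycle.lean`).  In the typer's T-es-12 vocabulary
(`HidaCohomology.degeneracyPullback`, `HidaCohomology.heckeU`, `Gamma0.degeneracyConj`):

* `heckeU_apply_eq_of_shiftInvariant` / `heckeU_eq_nsmul_of_shiftInvariant`: for a prime `ℓ ∤ N`, a degree-`0` cocycle
  (= homomorphism) `u : Γ₀(N) → R` with `π_ℓ^* u = π_1^* u` on `Γ₀(N ℓ)` satisfies `T_ℓ u = (ℓ + 1) · u` EXACTLY.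
  This is the cocycle form of `π_{1*} π_ℓ^* = T_ℓ` and `π_{1*} π_1^* = [Γ₀(N) : Γ₀(Nℓ)] = ℓ + 1`: writing each of the
  tree's `ℓ + 1` Hecke representatives as `βᵢ = cᵢ⁻¹ · diag(1, ℓ) · rᵢ` with `cᵢ, rᵢ ∈ Γ₀(N)`
  (`β_j = diag(1,ℓ)(1 j; 0 1)`, `β_∞ = diag(ℓ,1) = η⁻¹ diag(1,ℓ) g_∞` with `η = (x, -m; N, ℓ)`, `g_∞ = (ℓ x, -m; N, 1)`,
  `x ℓ + m N = 1`), the relation `γ'ᵢ β_{σ(i)} = βᵢ γ` (`heckePermElt_spec`) becomes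
  `(cᵢ γ'ᵢ c_{σ(i)}⁻¹) · diag(1,ℓ) = diag(1,ℓ) · (rᵢ γ r_{σ(i)}⁻¹)`, i.e. `εᵢ := cᵢ γ'ᵢ c_{σ(i)}⁻¹ ∈ Γ₀(Nℓ)` with
  `diag(ℓ,1) εᵢ diag(ℓ,1)⁻¹ = δᵢ := rᵢ γ r_{σ(i)}⁻¹`; shift-invariance gives `u(εᵢ) = u(δᵢ)`, hence
  `u(γ'ᵢ) = u(γ) + wᵢ − w_{σ(i)}` with `wᵢ = u(rᵢ) − u(cᵢ)`, and summing over the bijection `σ` (`heckePermEquiv`) gives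
  `(ℓ + 1) u(γ)`.
* Use (MEMO-es §21.2 (1)/(5), the «Eisenstein edge»): a congruence homomorphism that is torus-invariant modulo its level
  is shift-invariant at EVERY prime `ℓ` not dividing the level, hence has `T_ℓ = ℓ + 1` for all such `ℓ`; against a
  generalised Hecke eigenvector `[𝔪_f^∞]` (`isHeckeGenEigenvector_functionalCocycle`) this forces `a_ℓ ≡ ℓ + 1` and, by the
  tree fact `not_irreducible_of_frobeniusTrace_congr`, reducibility of `W[p]` — the contradiction closing Z₁-classes.

Nothing about BSD or Manin's conjecture is proved here.  References: MEMO-es §21.2; [Shimura1971] §8.3 (8.3.2);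
[DiamondShurman2005] §5.2 (the `ℓ + 1` representatives); [DarmonDiamondTaylor1995] Lemma 4.28.
-/

set_option autoImplicit false
set_option linter.dupNamespace false

open scoped MatrixGroups

open CongruenceSubgroup Literature.NumberTheory.EllipticCurves.ModularForms
  Literature.NumberTheory.EllipticCurves.ModularForms.HidaCohomology

namespace Summit.BirchSwinnertonDyer.BirchSwinnertonDyer.Theorems.ManinLocalTwoThree

section ShiftHecke

variable {N : ℕ} {R : Type*} [CommRing R] {ℓ : ℕ} [NeZero ℓ] (hℓ : ℓ.Prime)

/-- Degree-`0` cocycles are homomorphisms: `u(γδ) = u(γ) + u(δ)` (plumbing). [folklore] -/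
theorem cocycle_zero_mul {u : Gamma0 N → Fin 1 → R} (hu : u ∈ cocycles 0 N R) (γ δ : Gamma0 N) :
    u (γ * δ) = u γ + u δ := by
  rw [(mem_cocycles_iff.mp hu) γ δ, act_zero_eq_id, LinearMap.id_apply, add_comm]

/-- Degree-`0` cocycles are homomorphisms: `u(γ⁻¹) = -u(γ)` (plumbing). [folklore] -/
theorem cocycle_zero_inv {u : Gamma0 N → Fin 1 → R} (hu : u ∈ cocycles 0 N R) (γ : Gamma0 N) :
    u γ⁻¹ = -u γ := by
  rw [cocycle_map_inv hu γ, act_zero_eq_id, LinearMap.id_apply]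

/-- **The key per-representative identity.**  Suppose the Hecke representatives are written `cᵢ βᵢ = diag(1,ℓ) rᵢ` with
`cᵢ, rᵢ ∈ Γ₀(N)`, and `u` is a degree-`0` cocycle with `π_ℓ^* u = π_1^* u` on `Γ₀(L)`, `L = N ℓ`.  Then for every
`γ ∈ Γ₀(N)` and every index `i`, `u(γ'ᵢ) = u(γ) + (u(rᵢ) − u(cᵢ)) − (u(r_{σ(i)}) − u(c_{σ(i)}))` where
`γ'ᵢ β_{σ(i)} = βᵢ γ` (`heckePermElt`, `heckePerm`). [folklore] -/
theorem apply_heckePermElt_eq_of_shiftInvariant {L : ℕ} (hL1 : N * 1 ∣ L) (hLℓ : N * ℓ ∣ L) (hL : L ∣ N * ℓ)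
    (c r : HeckeIdx N ℓ → Gamma0 N) (hcr : ∀ i, gmat (c i) * heckeRep ℓ i.1 = !![1, 0; 0, (ℓ : ℤ)] * gmat (r i))
    {u : Gamma0 N → Fin 1 → R} (hu : u ∈ cocycles 0 N R)
    (hS : degeneracyPullback 0 N L ℓ R hLℓ u = degeneracyPullback 0 N L 1 R hL1 u) (γ : Gamma0 N)
    (i : HeckeIdx N ℓ) :
    u (heckePermElt hℓ γ i) =
      u γ + (u (r i) - u (c i)) - (u (r (heckePerm hℓ γ i)) - u (c (heckePerm hℓ γ i))) := by
  set σi := heckePerm hℓ γ i with hσi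
  set γ' := heckePermElt hℓ γ i with hγ'
  set α : Matrix (Fin 2) (Fin 2) ℤ := !![1, 0; 0, (ℓ : ℤ)] with hα
  set ε : Gamma0 N := c i * γ' * (c σi)⁻¹ with hε
  set δ : Gamma0 N := r i * γ * (r σi)⁻¹ with hδ
  have hℓ0 : (ℓ : ℤ) ≠ 0 := by exact_mod_cast NeZero.ne ℓ
  -- `ε α = α δ`
  have hspec : gmat γ' * heckeRep ℓ σi.1 = heckeRep ℓ i.1 * gmat γ := heckePermElt_spec hℓ γ i
  have key : gmat ε * α = α * gmat δ := by
    have hdet : (gmat (r σi)).det ≠ 0 := by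
      rw [gmat, Matrix.SpecialLinearGroup.det_coe]; exact one_ne_zero
    apply matrix_mul_right_cancel_of_det_ne_zero hdet
    have e1 : gmat ε * α * gmat (r σi) = gmat (c i) * gmat γ' * (gmat (c σi)⁻¹ * (gmat (c σi) * heckeRep ℓ σi.1)) := by
      rw [hcr σi, hε, gmat_mul, gmat_mul]; simp only [Matrix.mul_assoc]
    have e2 : gmat (c σi)⁻¹ * (gmat (c σi) * heckeRep ℓ σi.1) = heckeRep ℓ σi.1 := by
      rw [← Matrix.mul_assoc, ← gmat_mul, inv_mul_cancel, gmat_one, Matrix.one_mul]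
    have e3 : α * gmat δ * gmat (r σi) = α * gmat (r i) * gmat γ := by
      rw [hδ, gmat_mul, gmat_mul]
      simp only [Matrix.mul_assoc]
      rw [← gmat_mul ((r σi)⁻¹), inv_mul_cancel, gmat_one, Matrix.mul_one]
    rw [e1, e2, Matrix.mul_assoc, hspec, ← Matrix.mul_assoc, hcr i, e3]
  -- read off the entries
  have h00 : gmat ε 0 0 = gmat δ 0 0 := by
    have := congrFun (congrFun key 0) 0
    simpa [hα, Matrix.mul_apply, Fin.sum_univ_two] using this
  have h01 : gmat ε 0 1 * ℓ = gmat δ 0 1 := by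
    have := congrFun (congrFun key 0) 1
    simpa [hα, Matrix.mul_apply, Fin.sum_univ_two] using this
  have h10 : gmat ε 1 0 = ℓ * gmat δ 1 0 := by
    have := congrFun (congrFun key 1) 0
    simpa [hα, Matrix.mul_apply, Fin.sum_univ_two] using this
  have h11 : gmat ε 1 1 = gmat δ 1 1 := by
    have := congrFun (congrFun key 1) 1
    have h : gmat ε 1 1 * ℓ = ℓ * gmat δ 1 1 := by
      simpa [hα, Matrix.mul_apply, Fin.sum_univ_two] using this
    rw [mul_comm] at h
    exact mul_left_cancel₀ hℓ0 h
  -- `ε ∈ Γ₀(L)`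
  have hδN : (N : ℤ) ∣ gmat δ 1 0 := by
    have h := δ.2
    rw [Gamma0_mem] at h
    exact (ZMod.intCast_zmod_eq_zero_iff_dvd _ N).mp h
  have hεL : (ε : SL(2, ℤ)) ∈ Gamma0 L := by
    rw [Gamma0_mem]
    refine (ZMod.intCast_zmod_eq_zero_iff_dvd _ L).mpr ?_
    have h1 : (L : ℤ) ∣ (N : ℤ) * ℓ := by exact_mod_cast hL
    refine h1.trans ?_
    change (N : ℤ) * ℓ ∣ gmat ε 1 0
    rw [h10, mul_comm (N : ℤ)]
    exact mul_dvd_mul_left (ℓ : ℤ) hδN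
  -- `diag(ℓ,1) ε diag(ℓ,1)⁻¹ = δ` and `π_1^* ε = ε`
  have hconjℓ : Gamma0.degeneracyConj N L ℓ hLℓ ⟨(ε : SL(2, ℤ)), hεL⟩ = δ := by
    apply Subtype.ext
    ext a b
    fin_cases a <;> fin_cases b
    · simpa [Gamma0.degeneracyConjElt] using h00
    · change (ℓ : ℤ) * gmat ε 0 1 = gmat δ 0 1
      rw [mul_comm]; exact h01
    · change gmat ε 1 0 / ℓ = gmat δ 1 0
      rw [h10, Int.mul_ediv_cancel_left _ hℓ0]
    · simpa [Gamma0.degeneracyConjElt] using h11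
  have hconj1 : Gamma0.degeneracyConj N L 1 hL1 ⟨(ε : SL(2, ℤ)), hεL⟩ = ε :=
    Subtype.ext (Gamma0.coe_degeneracyConj_one hL1 _)
  -- shift-invariance at `ε`: `u δ = u ε`
  have huεδ : u δ = u ε := by
    have := congrFun hS ⟨(ε : SL(2, ℤ)), hεL⟩
    rw [degeneracyPullback_zero_apply, degeneracyPullback_one_apply, hconjℓ, hconj1] at this
    exact this
  -- unfold `ε`, `δ` through the homomorphism property
  have huε : u ε = u (c i) + u γ' - u (c σi) := by
    rw [hε, cocycle_zero_mul hu, cocycle_zero_mul hu, cocycle_zero_inv hu]; abel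
  have huδ : u δ = u (r i) + u γ - u (r σi) := by
    rw [hδ, cocycle_zero_mul hu, cocycle_zero_mul hu, cocycle_zero_inv hu]; abel
  rw [huε, huδ] at huεδ
  -- solve for `u γ'`
  have h2 : u γ' = u (c i) + u γ' - u (c σi) - u (c i) + u (c σi) := by abel
  rw [h2, ← huεδ]; abel

/-- **A matched family of Hecke representatives** for a prime `ℓ ∤ N`: `cᵢ βᵢ = diag(1,ℓ) rᵢ` with `cᵢ, rᵢ ∈ Γ₀(N)` —
`c_j = 1`, `r_j = (1 j; 0 1)`; `c_∞ = (x, -m; N, ℓ)`, `r_∞ = (ℓ x, -m; N, 1)` where `x ℓ + m N = 1` (Bézout).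
[folklore] -/
theorem exists_matched_heckeRep (hℓ : ℓ.Prime) (hℓN : ¬ ℓ ∣ N) :
    ∃ c r : HeckeIdx N ℓ → Gamma0 N, ∀ i, gmat (c i) * heckeRep ℓ i.1 = !![1, 0; 0, (ℓ : ℤ)] * gmat (r i) := by
  obtain ⟨x, m, hxm⟩ : IsCoprime (ℓ : ℤ) (N : ℤ) :=
    Nat.isCoprime_iff_coprime.mpr ((Nat.Prime.coprime_iff_not_dvd hℓ).mpr hℓN)
  -- the Bézout elements
  let ηm : SL(2, ℤ) := ⟨!![x, -m; (N : ℤ), (ℓ : ℤ)], by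
    rw [Matrix.det_fin_two_of]; linear_combination hxm⟩
  let gm : SL(2, ℤ) := ⟨!![(ℓ : ℤ) * x, -m; (N : ℤ), 1], by
    rw [Matrix.det_fin_two_of]; linear_combination hxm⟩
  have hηm : ηm ∈ Gamma0 N := by
    rw [Gamma0_mem]; change (((N : ℤ)) : ZMod N) = 0; simp
  have hgm : gm ∈ Gamma0 N := by
    rw [Gamma0_mem]; change (((N : ℤ)) : ZMod N) = 0; simp
  let Um : ℤ → SL(2, ℤ) := fun j ↦ ⟨!![1, j; 0, 1], by rw [Matrix.det_fin_two_of]; ring⟩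
  have hUm : ∀ j, Um j ∈ Gamma0 N := by
    intro j; rw [Gamma0_mem]; change (((0 : ℤ)) : ZMod N) = 0; simp
  refine ⟨fun i ↦ i.1.elim ⟨ηm, hηm⟩ (fun _ ↦ 1), fun i ↦ i.1.elim ⟨gm, hgm⟩ (fun j ↦ ⟨Um j.val, hUm j.val⟩), ?_⟩
  rintro ⟨_ | j, hi⟩
  · -- `i = ∞`
    change gmat (⟨ηm, hηm⟩ : Gamma0 N) * heckeRep ℓ none = !![1, 0; 0, (ℓ : ℤ)] * gmat (⟨gm, hgm⟩ : Gamma0 N)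
    ext a b
    fin_cases a <;> fin_cases b <;>
      simp [gmat, ηm, gm, heckeRep, Matrix.mul_apply, Fin.sum_univ_two] <;> ring
  · -- `i = j`
    change gmat (1 : Gamma0 N) * heckeRep ℓ (some j) = !![1, 0; 0, (ℓ : ℤ)] * gmat (⟨Um j.val, hUm j.val⟩ : Gamma0 N)
    ext a b
    fin_cases a <;> fin_cases b <;>
      simp [gmat, Um, heckeRep, Matrix.mul_apply, Fin.sum_univ_two]

/-- For `ℓ ∤ N` the index set of `T_ℓ` has `ℓ + 1` elements (`ℤ/ℓ` and `∞`). [cite: DiamondShurman2005, Prop. 5.2.1] -/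
theorem card_heckeIdx (hℓN : ¬ ℓ ∣ N) : Fintype.card (HeckeIdx N ℓ) = ℓ + 1 := by
  rw [Fintype.card_congr (Equiv.subtypeUnivEquiv (fun (i : Option (ZMod ℓ)) (_ : i = none) ↦ hℓN)),
    Fintype.card_option, ZMod.card]

/-- **Shift-invariant ⟹ `T_ℓ`-eigenvalue `ℓ + 1`, pointwise.**  For a prime `ℓ ∤ N`, `L = Nℓ` (two-sided divisibility),
and a degree-`0` cocycle `u` on `Γ₀(N)` with `π_ℓ^* u = π_1^* u` on `Γ₀(L)`: `(T_ℓ u)(γ) = (ℓ + 1) · u(γ)`.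
[folklore] -/
theorem heckeU_apply_eq_of_shiftInvariant (hℓN : ¬ ℓ ∣ N) {L : ℕ} (hL1 : N * 1 ∣ L) (hLℓ : N * ℓ ∣ L)
    (hL : L ∣ N * ℓ) {u : Gamma0 N → Fin 1 → R} (hu : u ∈ cocycles 0 N R)
    (hS : degeneracyPullback 0 N L ℓ R hLℓ u = degeneracyPullback 0 N L 1 R hL1 u) (γ : Gamma0 N) :
    heckeU 0 N R hℓ u γ = (ℓ + 1) • u γ := by
  haveI : Fact ℓ.Prime := ⟨hℓ⟩
  obtain ⟨c, r, hcr⟩ := exists_matched_heckeRep hℓ hℓN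
  set w : HeckeIdx N ℓ → Fin 1 → R := fun i ↦ u (r i) - u (c i) with hw
  rw [heckeU_apply]
  have hterm : ∀ i : HeckeIdx N ℓ, act 0 (heckeRep ℓ (heckePerm hℓ γ i).1) (u (heckePermElt hℓ γ i)) =
      u γ + w i - w (heckePerm hℓ γ i) := by
    intro i
    rw [act_zero_eq_id, LinearMap.id_apply,
      apply_heckePermElt_eq_of_shiftInvariant hℓ hL1 hLℓ hL c r hcr hu hS γ i]
  rw [Finset.sum_congr rfl fun i _ ↦ hterm i, Finset.sum_sub_distrib, Finset.sum_add_distrib,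
    Finset.sum_const, Finset.card_univ, card_heckeIdx hℓN]
  have hσ : ∑ i, w (heckePerm hℓ γ i) = ∑ i, w i := by
    rw [← Equiv.sum_comp (heckePermEquiv hℓ γ) w]
    rfl
  rw [hσ]; abel

/-- **Shift-invariant ⟹ `T_ℓ u = (ℓ + 1) u`** (the cocycle form of `π_{1*} π_ℓ^* = T_ℓ`, `π_{1*} π_1^* = ℓ + 1`).
[folklore] -/
theorem heckeU_eq_nsmul_of_shiftInvariant (hℓN : ¬ ℓ ∣ N) {L : ℕ} (hL1 : N * 1 ∣ L) (hLℓ : N * ℓ ∣ L)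
    (hL : L ∣ N * ℓ) {u : Gamma0 N → Fin 1 → R} (hu : u ∈ cocycles 0 N R)
    (hS : degeneracyPullback 0 N L ℓ R hLℓ u = degeneracyPullback 0 N L 1 R hL1 u) :
    heckeU 0 N R hℓ u = (ℓ + 1) • u := by
  funext γ
  rw [heckeU_apply_eq_of_shiftInvariant hℓ hℓN hL1 hLℓ hL hu hS γ, Pi.smul_apply]

/-- The same with the scalar `(ℓ + 1 : R)` (the form consumed by `Module.End.maxGenEigenspace`). [folklore] -/
theorem heckeU_eq_smul_of_shiftInvariant (hℓN : ¬ ℓ ∣ N) {L : ℕ} (hL1 : N * 1 ∣ L) (hLℓ : N * ℓ ∣ L)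
    (hL : L ∣ N * ℓ) {u : Gamma0 N → Fin 1 → R} (hu : u ∈ cocycles 0 N R)
    (hS : degeneracyPullback 0 N L ℓ R hLℓ u = degeneracyPullback 0 N L 1 R hL1 u) :
    heckeU 0 N R hℓ u = ((ℓ : R) + 1) • u := by
  rw [heckeU_eq_nsmul_of_shiftInvariant hℓ hℓN hL1 hLℓ hL hu hS, ← Nat.cast_smul_eq_nsmul R, Nat.cast_succ]

end ShiftHecke

end Summit.BirchSwinnertonDyer.BirchSwinnertonDyer.Theorems.ManinLocalTwoThree
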